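/-
Origin: expansion seat `planner-pub-hodgecm-pohl-g15-0`, handover #12 2026-08-18T16:19:39Z (md5 7418d07b789dc000acdc247946031edd, 235 l.; RUN-32 CANDIDATE ROW, ON REQUEST ONLY — TREE-SHAPE SPLIT (≤400 l.) of the pohl lineage, source lines verbatim; NEW first part; lands AFTER — (imports PKG CM.Lemmas + NaiveSpanCriterion); no import rewrite) (`HOME/pub-hodgecm-pohl-g15/lean/Pohl15/GaloisSpanCondition.lean`, md5 7418d07b, 235 lines);
landed by the packager successor (mc-unitary-1-g3, gen-8 kit) in gate run 32 as `HodgeCM/Proofs/Pohlmann/GaloisSpanCondition.lean` (verbatim).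
-/
/-
Copyright: pub-hodgecm formalisation cell (harness21, 2026). New file (not vendored).
Origin: HOME/pub-hodgecm-pohl-g15/lean/Pohl15/GaloisSpanCondition.lean — session planner-pub-hodgecm-pohl-g15-0 (unit pub-hodgecm-pohl-g15),
EXPANSION part (b) `PohlmannSpan`, generation 15: TREE-SHAPE STAGING under the 400-line rule of lean/CONVENTIONS.md §2 — part 1/2
of the split of `HodgeCM/Proofs/Pohlmann/GaloisSpanCriterion.lean` (pohl-g13, gate run 30; 556 l., md5 8c9eaa98b30c): source lines 62–267 VERBATIM; the module docstring below is new (it only describes the cut).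
Intended final place: `HodgeCM/Proofs/Pohlmann/GaloisSpanCondition.lean` (module `HodgeCM.Proofs.Pohlmann.GaloisSpanCondition`); imports final (certified package modules only).
-/
import Summits.HodgeConjecture.HodgeCM.CM.Lemmas
import Summits.HodgeConjecture.HodgeCM.Proofs.Pohlmann.NaiveSpanCriterion

/-!
# When do the two index sets agree?  I: antisymmetrised graphs, the Galois span condition, level independence

First half of the former `GaloisSpanCriterion.lean` (pohl-g13), split at its section boundary `end Level` under the tree's
400-line rule (lean/CONVENTIONS.md §2); every declaration below is the source's, verbatim.  Contents: `section AntiInd` — the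
antisymmetrised graphs `a_g` of self-maps of `Hom(F, ℂ)`, the Galois anti-span `galAntiSpan F n` and the condition
`GalSpanCondition F n` (every Galois translate's anti-indicator lies in the Galois anti-span); the count
`Σ_j Σ_{s ∈ S_j} 1_{Θ_j}(g s)` as an affine function of `a_g`; `section Level` — the Galois anti-span and the condition do not depend
on the number of factors (`galAntiSpan_eq`, `galSpanCondition_iff`).  Necessity / sufficiency (THEOREMS A and B), the criterion
`galSpanCondition_iff_indexSetsAgree` and its reading for the naive Pohlmann span are in `GaloisSpanCriterion.lean`, which imports this
file and keeps the module name.  Nothing is cited; everything is kernel-checked.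
-/

noncomputable section

open scoped TensorProduct NumberField BigOperators
open NumberField NumberField.ComplexEmbedding

attribute [local instance] Classical.propDecidable

namespace HodgeCM

open Literature.AlgebraicGeometry.Motives (CMType HodgeStructure)
open Literature.AlgebraicGeometry.Motives.HodgeStructure (ofRat ofRat_apply)
open HodgeCM.Pohlmann HodgeCM.GaoUllmo HodgeCM.CMTypeOps

namespace NonGalois

/-! ### Antisymmetrised graphs of self-maps of `Hom(F, ℂ)` and the Galois span condition -/

section AntiInd

variable {F : Type} [Field F]

/-- The **antisymmetrised graph** of a self-map `g` of `Hom(F, ℂ)`: the function `a_g(s, x) = [g s = x] − [conj (g s) = x]` on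
`Hom(F, ℂ) × Hom(F, ℂ)` (row `s` is `e_{g s} − e_{conj (g s)}`). -/
def antiInd (g : (F →+* ℂ) → (F →+* ℂ)) : (F →+* ℂ) × (F →+* ℂ) → ℚ :=
  fun q => (if g q.1 = q.2 then 1 else 0) - (if conjugate (g q.1) = q.2 then 1 else 0)

/-- (Ported verbatim from the HodgeCMPerL package; no docstring in the source.) -/
theorem antiInd_apply (g : (F →+* ℂ) → (F →+* ℂ)) (s x : F →+* ℂ) :
    antiInd g (s, x) = (if g s = x then 1 else 0) - (if conjugate (g s) = x then 1 else 0) := rfl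

variable [NumberField F] {n : ℕ}

variable (F n) in
/-- The `ℚ`-span of the antisymmetrised graphs `a_σ` of the elements `σ ∈ Gal(E^c/ℚ)`, `E = F^{n+1}`, acting on `Hom(F, ℂ)` by
`s ↦ σ ∘ s` (`GaoUllmo.galF n`). -/
def galAntiSpan : Submodule ℚ ((F →+* ℂ) × (F →+* ℂ) → ℚ) :=
  Submodule.span ℚ (Set.range fun σ : galoisClosure (Fin (n + 1) → F) ≃ₐ[ℚ] galoisClosure (Fin (n + 1) → F) =>
    antiInd (galF n σ))

/-- (Ported verbatim from the HodgeCMPerL package; no docstring in the source.) -/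
theorem antiInd_galF_mem_galAntiSpan (σ : galoisClosure (Fin (n + 1) → F) ≃ₐ[ℚ] galoisClosure (Fin (n + 1) → F)) :
    antiInd (galF n σ) ∈ galAntiSpan F n :=
  Submodule.subset_span ⟨σ, rfl⟩

variable (F n) in
/-- **The Galois span condition** `LIN_n(F)`: for every Galois translate `P ∈ GalT F` (a permutation of `Hom(F, ℂ)` commuting with
pre-composition by `Aut(F/ℚ)`), the antisymmetrised graph `a_P` is a `ℚ`-linear combination of the `a_σ`, `σ ∈ Gal(E^c/ℚ)`
(`E = F^{n+1}`).  A finite condition on the number field `F` alone (and the number of factors). -/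
def GalSpanCondition : Prop :=
  ∀ P : GalT F, antiInd P.1 ∈ galAntiSpan F n

/-- If every Galois translate is induced by an element of `Gal(E^c/ℚ)` (`galTOf` onto), the Galois span condition holds trivially:
each `a_P` is an `a_σ`. -/
theorem galSpanCondition_of_galTOf_surjective (h : Function.Surjective (galTOf (F := F) (n := n))) :
    GalSpanCondition F n := fun P => by
  obtain ⟨σ, rfl⟩ := h P
  exact antiInd_galF_mem_galAntiSpan σ

/-- For `F` Galois over `ℚ` the Galois span condition holds (`GaoUllmo.galTOf_surjective`). -/
theorem galSpanCondition_of_isGalois [IsGalois ℚ F] : GalSpanCondition F n :=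
  galSpanCondition_of_galTOf_surjective galTOf_surjective

/-! ### The count `Σ_j Σ_{s ∈ S_j} 1_{Θ_j}(g s)` is an affine function of the antisymmetrised graph `a_g` -/

/-- Pairing a weight `w` on `Hom(F, ℂ)` with row `s` of `a_g`: `Σ_x w(x) a_g(s, x) = w(g s) − w(conj (g s))`. -/
theorem sum_mul_antiInd (w : (F →+* ℂ) → ℚ) (g : (F →+* ℂ) → (F →+* ℂ)) (s : F →+* ℂ) :
    ∑ x, w x * antiInd g (s, x) = w (g s) - w (conjugate (g s)) := by
  simp only [antiInd_apply, mul_sub, mul_ite, mul_one, mul_zero, Finset.sum_sub_distrib]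
  rw [Finset.sum_ite_eq Finset.univ (g s), Finset.sum_ite_eq Finset.univ (conjugate (g s))]
  simp only [Finset.mem_univ, if_true]

/-- Every row of `a_g` sums to zero, hence so does `a_g`. -/
theorem sum_antiInd (g : (F →+* ℂ) → (F →+* ℂ)) : ∑ q, antiInd g q = 0 := by
  rw [Fintype.sum_prod_type]
  refine Finset.sum_eq_zero fun s _ => ?_
  simpa using sum_mul_antiInd (fun _ => (1 : ℚ)) g s

/-- `Σ_x 1_Θ(x) · a_g(s, x) = 1_Θ(g s) − 1_Θ(conj (g s)) = 2·1_Θ(g s) − 1` for a CM type `Θ`. -/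
theorem sum_ind_mul_antiInd (Θ : CMType F) (g : (F →+* ℂ) → (F →+* ℂ)) (s : F →+* ℂ) :
    ∑ x, (ind Θ x : ℚ) * antiInd g (s, x) = 2 * (ind Θ (g s) : ℚ) - 1 := by
  have h1 : (ind Θ (g s) : ℚ) + ind Θ (conjugate (g s)) = 1 := by
    exact_mod_cast ind_add_ind_conjugate Θ (g s)
  rw [sum_mul_antiInd (fun x => (ind Θ x : ℚ)) g s]
  linarith

/-- The test functional of a family of CM types `Θ` and a weight `S`: `f ↦ Σ_j Σ_{s ∈ S_j} Σ_x 1_{Θ_j}(x) f(s, x)`. -/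
def weightPairing (Θ : Fin (n + 1) → CMType F) (S : Fin (n + 1) → Finset (F →+* ℂ)) :
    ((F →+* ℂ) × (F →+* ℂ) → ℚ) →ₗ[ℚ] ℚ where
  toFun f := ∑ j, ∑ s ∈ S j, ∑ x, (ind (Θ j) x : ℚ) * f (s, x)
  map_add' f f' := by
    simp only [Pi.add_apply, mul_add, Finset.sum_add_distrib]
  map_smul' c f := by
    simp only [Pi.smul_apply, smul_eq_mul, RingHom.id_apply, Finset.mul_sum, mul_left_comm]

/-- (Ported verbatim from the HodgeCMPerL package; no docstring in the source.) -/
theorem weightPairing_apply (Θ : Fin (n + 1) → CMType F) (S : Fin (n + 1) → Finset (F →+* ℂ))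
    (f : (F →+* ℂ) × (F →+* ℂ) → ℚ) :
    weightPairing Θ S f = ∑ j, ∑ s ∈ S j, ∑ x, (ind (Θ j) x : ℚ) * f (s, x) := rfl

/-- On an antisymmetrised graph the test functional is `2·(count) − |S|`. -/
theorem weightPairing_antiInd (Θ : Fin (n + 1) → CMType F) (S : Fin (n + 1) → Finset (F →+* ℂ))
    (g : (F →+* ℂ) → (F →+* ℂ)) :
    weightPairing Θ S (antiInd g) =
      2 * (∑ j, ∑ s ∈ S j, (ind (Θ j) (g s) : ℚ)) - ∑ j, ((S j).card : ℚ) := by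
  simp only [weightPairing_apply, sum_ind_mul_antiInd, Finset.sum_sub_distrib, Finset.mul_sum, Finset.sum_const,
    nsmul_eq_mul, mul_one]

/-- A Galois-closure Hodge weight kills the whole Galois span: `weightPairing Θ S` vanishes on `galAntiSpan F n`. -/
theorem galAntiSpan_le_ker_weightPairing {Θ : Fin (n + 1) → CMType F} {p : ℕ} {S : Fin (n + 1) → Finset (F →+* ℂ)}
    (hS : IsHodgeWeightC Θ p S) : galAntiSpan F n ≤ LinearMap.ker (weightPairing Θ S) := by
  refine Submodule.span_le.mpr ?_
  rintro _ ⟨σ, rfl⟩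
  rw [SetLike.mem_coe, LinearMap.mem_ker, weightPairing_antiInd]
  have h2 : (∑ j, ∑ s ∈ S j, (ind (Θ j) (galF n σ s) : ℚ)) = p := by exact_mod_cast hS.2 σ
  have h1 : (∑ j, ((S j).card : ℚ)) = 2 * p := by exact_mod_cast hS.1
  rw [h2, h1, sub_self]

/-- **The count at any self-map in the Galois span.**  If `S` is a Galois-closure Hodge weight of `(Θ, p)` and `a_g ∈ galAntiSpan F n`,
then `#{(j, s) : s ∈ S_j, g s ∈ Θ_j} = p`. -/
theorem sum_ind_eq_of_mem_galAntiSpan {Θ : Fin (n + 1) → CMType F} {p : ℕ} {S : Fin (n + 1) → Finset (F →+* ℂ)}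
    (hS : IsHodgeWeightC Θ p S) {g : (F →+* ℂ) → (F →+* ℂ)} (hg : antiInd g ∈ galAntiSpan F n) :
    (∑ j, ∑ s ∈ S j, ind (Θ j) (g s)) = (p : ℤ) := by
  have h0 : weightPairing Θ S (antiInd g) = 0 := LinearMap.mem_ker.mp (galAntiSpan_le_ker_weightPairing hS hg)
  rw [weightPairing_antiInd] at h0
  have h1 : (∑ j, ((S j).card : ℚ)) = 2 * p := by exact_mod_cast hS.1
  have hq : (∑ j, ∑ s ∈ S j, (ind (Θ j) (g s) : ℚ)) = p := by linarith
  exact_mod_cast hq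

/-- **THEOREM (sufficiency of the Galois span condition).**  If `GalSpanCondition F n` holds, the two index sets agree at every
`(Θ, p)` on `n + 1` factors: every Galois-closure Hodge weight is an old Hodge weight. -/
theorem indexSetsAgree_of_galSpanCondition (h : GalSpanCondition F n) (Θ : Fin (n + 1) → CMType F) (p : ℕ) :
    IndexSetsAgree Θ p :=
  fun _S hS => ⟨hS.1, fun P => sum_ind_eq_of_mem_galAntiSpan hS (h P)⟩

end AntiInd

/-! ### The Galois span does not depend on the number of factors -/

section Level

variable {F : Type} [Field F] [NumberField F]

/-- `E_n^c ≤ E_m^c` (`E_k = F^{k+1}`): the Galois closure of `F^{k+1}` in `ℂ` is generated by the images `s(F)`, `s ∈ Hom(F, ℂ)`,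
whatever `k`. -/
theorem galoisClosure_pi_le (n m : ℕ) : galoisClosure (Fin (n + 1) → F) ≤ galoisClosure (Fin (m + 1) → F) := by
  rw [galoisClosure, IntermediateField.adjoin_le_iff]
  intro z hz
  obtain ⟨φ, ⟨a, rfl⟩⟩ := Set.mem_iUnion.mp hz
  obtain ⟨j, s, rfl⟩ := exists_eq_piEmb φ
  rw [piEmb_apply]
  exact apply_mem_galoisClosure s (a j)

/-- `E_n^c = E_m^c` as subfields of `ℂ`. -/
theorem galoisClosure_pi_eq (n m : ℕ) : galoisClosure (Fin (n + 1) → F) = galoisClosure (Fin (m + 1) → F) :=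
  le_antisymm (galoisClosure_pi_le n m) (galoisClosure_pi_le m n)

/-- Every `σ ∈ Gal(E_m^c/ℚ)` acts on `Hom(F, ℂ)` as some `σ' ∈ Gal(E_n^c/ℚ)` (transport along `E_n^c = E_m^c`). -/
theorem exists_galF_eq (n : ℕ) {m : ℕ} (σ : galoisClosure (Fin (m + 1) → F) ≃ₐ[ℚ] galoisClosure (Fin (m + 1) → F)) :
    ∃ σ' : galoisClosure (Fin (n + 1) → F) ≃ₐ[ℚ] galoisClosure (Fin (n + 1) → F), galF n σ' = galF m σ := by
  let ι : galoisClosure (Fin (n + 1) → F) →ₐ[ℚ] galoisClosure (Fin (m + 1) → F) :=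
    IntermediateField.inclusion (galoisClosure_pi_le n m)
  let ρ : galoisClosure (Fin (n + 1) → F) →ₐ[ℚ] ℂ :=
    ((galoisClosure (Fin (m + 1) → F)).val.comp (σ : galoisClosure (Fin (m + 1) → F) →ₐ[ℚ] galoisClosure (Fin (m + 1) → F))).comp ι
  refine ⟨autOfEmb ρ, funext fun s => RingHom.ext fun a => ?_⟩
  rw [galF_autOfEmb_apply, galF_apply]
  rfl

/-- The set of self-maps of `Hom(F, ℂ)` induced by `Gal(E^c/ℚ)` does not depend on the number of factors. -/
theorem range_galF_eq (n m : ℕ) : Set.range (galF (F := F) n) = Set.range (galF (F := F) m) := by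
  ext g
  constructor
  · rintro ⟨σ, rfl⟩
    obtain ⟨σ', h⟩ := exists_galF_eq m σ
    exact ⟨σ', h⟩
  · rintro ⟨σ, rfl⟩
    obtain ⟨σ', h⟩ := exists_galF_eq n σ
    exact ⟨σ', h⟩

/-- Nor does the set of Galois translates it induces (`galTOf`). -/
theorem range_galTOf_eq (n m : ℕ) : Set.range (galTOf (F := F) (n := n)) = Set.range (galTOf (F := F) (n := m)) := by
  ext P
  constructor
  · rintro ⟨σ, rfl⟩
    obtain ⟨σ', h⟩ := exists_galF_eq m σ
    exact ⟨σ', Subtype.ext (Equiv.ext fun s => by rw [galTOf_apply, galTOf_apply, h])⟩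
  · rintro ⟨σ, rfl⟩
    obtain ⟨σ', h⟩ := exists_galF_eq n σ
    exact ⟨σ', Subtype.ext (Equiv.ext fun s => by rw [galTOf_apply, galTOf_apply, h])⟩

/-- Nor does the Galois span. -/
theorem galAntiSpan_eq (n m : ℕ) : galAntiSpan F n = galAntiSpan F m := by
  unfold galAntiSpan
  congr 1
  ext a
  simp only [Set.mem_range]
  constructor
  · rintro ⟨σ, rfl⟩
    obtain ⟨σ', h⟩ := exists_galF_eq m σ
    exact ⟨σ', by rw [h]⟩
  · rintro ⟨σ, rfl⟩
    obtain ⟨σ', h⟩ := exists_galF_eq n σ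
    exact ⟨σ', by rw [h]⟩

/-- Nor does the Galois span condition: it is a property of the number field `F`. -/
theorem galSpanCondition_iff (n m : ℕ) : GalSpanCondition F n ↔ GalSpanCondition F m := by
  unfold GalSpanCondition
  rw [galAntiSpan_eq n m]

end Level

end NonGalois

end HodgeCM

end
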